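import Summits.AtomisticToContinuum.Crystallization.Theorems.ChessboardParticlePlanesPeriodicWindowsShapeStationarity4
import Summits.AtomisticToContinuum.Crystallization.Theorems.PhononSlackCertificatesPeriodicGivenLayeredWindowBounds

/-!
# Crux `PeriodicWindows` (stmt-AtomisticToContinuum-3240), line `Sketch` — stub E2a, part 5: the finite-window inequalities

Helper file for the registered stub `stub_shapeStationarity` (E2a) of the lead skeleton `PeriodicWindowsSketch`
(rev 9). With the SITE SHAPE SUMS `σₙ(k) = barlowSiteEnergy Vₙ 1 c s k` (`Vₙ r = (r²)⁻ⁿ`) of a Barlow stacking of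
shape `c` and their LAYER AVERAGES `uₙ(K) = (2K+1)⁻¹ ∑_{|k| ≤ K} σₙ(k)`:

* `shp_sigma_bounds` — `1/2 ≤ σₙ(k) ≤ Bₙ(c)` uniformly in the layer (packing bound above; the in-layer neighbour at
  distance `1` below);
* `shp_cube_energy` — the Lennard-Jones site energies of the cube window `W_K` of `A '' barlowStacking a (a c) s` sum to
  `(2K+1)³ · 2 ((1/12)(a²)⁻⁶ u₆(K) − (1/6)(a²)⁻³ u₃(K))`;
* `shp_upper_window` — **(U) on cube windows**: if the stacking is two-way matched at every scale by translates of a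
  sequence of Lennard-Jones ground states then, for some `C` and all `K`,
  `2 ((1/12)(a²)⁻⁶ u₆(K) − (1/6)(a²)⁻³ u₃(K)) ≤ 2 E((2K+1)³)/(2K+1)³ + C ∂_K/(2K+1)³` (`LayeredHull.wb_upper`);
* `shp_lower_window` — **(L) on cube windows, for EVERY scale `a' > 0`** (no hull hypothesis): for some `C` and all `K`,
  `2 E((2K+1)³)/(2K+1)³ ≤ 2 ((1/12)(a'²)⁻⁶ u₆(K) − (1/6)(a'²)⁻³ u₃(K)) + C ∂'_K/(2K+1)³` (`LayeredHull.wb_lower`: the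
  ground-state energy of `(2K+1)³` particles is at most the energy of the dilated window).

All `[folklore]`.
-/

noncomputable section

namespace Summit.AtomisticToContinuum.Crystallization.Theorems.PeriodicWindowsSketch

open Literature.MathematicalPhysics.StatisticalMechanics
open Summit.AtomisticToContinuum.Crystallization.Theorems.ExcessDecayLiouvilleCoarseGrains (hcpSumCube)

/-! ## Uniform bounds on the site shape sums -/

/-- `Vₙ 0 = 0` for `n ≥ 1` (`0⁻¹ = 0`). [folklore] -/
theorem shp_shape_zero {n : ℕ} (hn : 1 ≤ n) : (fun r : ℝ => (r ^ 2)⁻¹ ^ n) 0 = 0 := by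
  simp only [ne_eq, OfNat.ofNat_ne_zero, not_false_eq_true, zero_pow, inv_zero]
  exact zero_pow (by omega)

/-- The in-layer neighbour `(k, 1, 0)` of the base point of layer `k` is at distance `1` (unit in-layer spacing).
[folklore] -/
theorem shp_dist_neighbour (c : ℝ) (s : ℤ → ℤ) (k : ℤ) :
    dist (barlowPos 1 c s k 0 0) (barlowPos 1 c s k 1 0) = 1 := by
  rw [dist_barlowPos_eq_norm_layerVec, sub_self, sub_self, sub_zero, sub_zero, norm_layerVec]
  norm_num

/-- **Uniform bounds on the site shape sums**: for `c > 0`, `n ≥ 2` and every layer `k`,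
`1/2 ≤ barlowSiteEnergy Vₙ 1 c s k ≤ 512 / ((min 1 c)³ (min 1 c)^{2n-3})`. [folklore] -/
theorem shp_sigma_bounds {c : ℝ} (hc : 0 < c) (s : ℤ → ℤ) {n : ℕ} (hn : 2 ≤ n) (k : ℤ) :
    1 / 2 ≤ barlowSiteEnergy (fun r => (r ^ 2)⁻¹ ^ n) 1 c s k ∧
      barlowSiteEnergy (fun r => (r ^ 2)⁻¹ ^ n) 1 c s k ≤ 512 / ((min 1 c) ^ 3 * (min 1 c) ^ (2 * n - 3)) := by
  have hG := shp_summable_shape_index one_pos hc s (k, 0, 0) n hn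
  have h2 := shp_two_mul_barlowSiteEnergy_eq_tsum (a := 1) (h := c) s (fun r : ℝ => (r ^ 2)⁻¹ ^ n)
    (shp_shape_zero (by omega)) k hG
  have hnonneg : ∀ t : ℤ × ℤ × ℤ,
      0 ≤ ((dist (barlowPos 1 c s k 0 0) (barlowPos 1 c s t.1 t.2.1 t.2.2)) ^ 2)⁻¹ ^ n := fun t => by positivity
  constructor
  · -- the neighbour term is `1`
    have hle := hG.le_tsum (k, 1, 0) fun t _ => hnonneg t
    simp only [shp_dist_neighbour, one_pow, inv_one] at hle
    linarith
  · -- packing bound on every finite partial sum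
    have hexp : 2 * n - 3 + 3 = 2 * n := by omega
    have hbound : ∀ T : Finset (ℤ × ℤ × ℤ), ∑ t ∈ T,
        ((dist (barlowPos 1 c s k 0 0) (barlowPos 1 c s t.1 t.2.1 t.2.2)) ^ 2)⁻¹ ^ n ≤
          1024 / ((min 1 c) ^ 3 * (min 1 c) ^ (2 * n - 3)) := by
      intro T
      have h := shp_sum_inv_pow_index_le one_pos hc s (k, 0, 0) (k := 2 * n - 3) (by omega) T
      rw [hexp] at h
      refine le_trans (le_of_eq (Finset.sum_congr rfl fun t _ => ?_)) h
      rw [shp_shape_eq_inv_pow]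
    have htsum := hG.tsum_le_of_sum_le hbound
    have : 2 * barlowSiteEnergy (fun r => (r ^ 2)⁻¹ ^ n) 1 c s k ≤ 1024 / ((min 1 c) ^ 3 * (min 1 c) ^ (2 * n - 3)) := by
      rw [h2]; exact htsum
    have e : (512 : ℝ) / ((min 1 c) ^ 3 * (min 1 c) ^ (2 * n - 3)) =
        (1024 / ((min 1 c) ^ 3 * (min 1 c) ^ (2 * n - 3))) / 2 := by ring
    rw [e]
    linarith

/-! ## The energy of a cube window in layer averages -/

/-- **Cube energy identity.** For `a', c > 0`, a linear isometry `A`, any label sequence `s` and every `K`: the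
Lennard-Jones site energies of the cube window of `A '' barlowStacking a' (a' c) s` sum to
`(2K+1)² · 2 ((1/12)(a'²)⁻⁶ Σ₆ − (1/6)(a'²)⁻³ Σ₃)` with `Σₙ = ∑_{|k| ≤ K} σₙ(k)`. [folklore] -/
theorem shp_cube_energy {a' c : ℝ} (ha' : 0 < a') (hc : 0 < c) (s : ℤ → ℤ)
    (A : EuclideanSpace ℝ (Fin 3) →ₗᵢ[ℝ] EuclideanSpace ℝ (Fin 3)) (K : ℕ) :
    ∑ p ∈ (hcpSumCube K).image (fun t : ℤ × ℤ × ℤ => A (barlowPos a' (a' * c) s t.1 t.2.1 t.2.2)),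
        (∑' q : {q : EuclideanSpace ℝ (Fin 3) // q ∈ A '' barlowStacking a' (a' * c) s ∧ q ≠ p},
          lennardJones (dist p (q : EuclideanSpace ℝ (Fin 3)))) =
      ((2 * K + 1 : ℕ) : ℝ) ^ 2 * ∑ k ∈ Finset.Icc (-(K : ℤ)) K,
        2 * ((1 / 12) * ((a' ^ 2)⁻¹ ^ 6 * barlowSiteEnergy (fun r => (r ^ 2)⁻¹ ^ 6) 1 c s k) -
          (1 / 6) * ((a' ^ 2)⁻¹ ^ 3 * barlowSiteEnergy (fun r => (r ^ 2)⁻¹ ^ 3) 1 c s k)) :=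
  shp_sum_cube_layer ha' (mul_pos ha' hc) s A K _ _ fun t => shp_site_lennardJones ha' hc s A t.1 t.2.1 t.2.2

/-- Regrouping of the cube energy: `∑_{|k| ≤ K} 2 (α σ₆(k) − β σ₃(k)) = 2 (α Σ₆ − β Σ₃)`. [folklore] -/
theorem shp_sum_layers_linear (α β : ℝ) (f g : ℤ → ℝ) (I : Finset ℤ) :
    ∑ k ∈ I, 2 * (α * f k - β * g k) = 2 * (α * ∑ k ∈ I, f k - β * ∑ k ∈ I, g k) := by
  have e : ∀ k, 2 * (α * f k - β * g k) = 2 * α * f k - 2 * β * g k := fun k => by ring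
  simp_rw [e, Finset.sum_sub_distrib, ← Finset.mul_sum]
  ring

/-! ## (U) and (L) on cube windows -/

/-- **(U) on cube windows.** If `A '' barlowStacking a (a c) s` (`a, c > 0`) is two-way matched at every scale by
translates of a sequence of Lennard-Jones ground states, then there is `C` such that for every `K`, with
`Σₙ = ∑_{|k| ≤ K} σₙ(k)` and `n_K = (2K+1)³`:
`(2K+1)² · 2 ((1/12)(a²)⁻⁶ Σ₆ − (1/6)(a²)⁻³ Σ₃) ≤ 2 E(n_K) + C ∂_K`. [folklore] -/
theorem shp_upper_window (x : (N : ℕ) → (Fin N → EuclideanSpace ℝ (Fin 3)))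
    (hx : ∀ N, IsGroundState lennardJones (x N)) {a c : ℝ} (ha : 0 < a) (hc : 0 < c) (s : ℤ → ℤ)
    (A : EuclideanSpace ℝ (Fin 3) →ₗᵢ[ℝ] EuclideanSpace ℝ (Fin 3))
    (hH : ∀ R ε : ℝ, 0 < ε → ∃ᶠ N in Filter.atTop, ∃ t : EuclideanSpace ℝ (Fin 3),
        (∀ p ∈ A '' barlowStacking a (a * c) s, ‖p‖ ≤ R → ∃ i : Fin N, dist (x N i + t) p ≤ ε) ∧
        (∀ i : Fin N, ‖x N i + t‖ ≤ R → ∃ p ∈ A '' barlowStacking a (a * c) s, dist (x N i + t) p ≤ ε)) :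
    ∃ C : ℝ, ∀ K : ℕ,
      ((2 * K + 1 : ℕ) : ℝ) ^ 2 * (2 * ((1 / 12) * ((a ^ 2)⁻¹ ^ 6 *
          ∑ k ∈ Finset.Icc (-(K : ℤ)) K, barlowSiteEnergy (fun r => (r ^ 2)⁻¹ ^ 6) 1 c s k) -
        (1 / 6) * ((a ^ 2)⁻¹ ^ 3 * ∑ k ∈ Finset.Icc (-(K : ℤ)) K, barlowSiteEnergy (fun r => (r ^ 2)⁻¹ ^ 3) 1 c s k))) ≤
      2 * groundStateEnergy lennardJones 3 ((2 * K + 1) ^ 3) +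
        C * ∑ p ∈ (hcpSumCube K).image (fun t : ℤ × ℤ × ℤ => A (barlowPos a (a * c) s t.1 t.2.1 t.2.2)),
          (1 + Metric.infDist p (A '' barlowStacking a (a * c) s \
            ↑((hcpSumCube K).image fun t : ℤ × ℤ × ℤ => A (barlowPos a (a * c) s t.1 t.2.1 t.2.2))))⁻¹ ^ 3 := by
  obtain ⟨C, hC⟩ := LayeredHull.wb_upper
  refine ⟨C, fun K => ?_⟩
  have h := hC x hx (A '' barlowStacking a (a * c) s) hH _ (shp_cube_subset a (a * c) s A K)
  rw [shp_cube_energy ha hc s A K, shp_cube_card ha (mul_pos ha hc) s A K, shp_sum_layers_linear,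
    ← Finset.mul_sum, ← Finset.mul_sum] at h
  exact h

/-- **(L) on cube windows, at every scale.** For `a', c > 0`, a Hägg... (any) label sequence `s` and a linear
isometry `A` there is `C` such that for every `K`:
`2 E((2K+1)³) ≤ (2K+1)² · 2 ((1/12)(a'²)⁻⁶ Σ₆ − (1/6)(a'²)⁻³ Σ₃) + C ∂'_K`, where `∂'` is the boundary functional of
the cube window of `A '' barlowStacking a' (a' c) s` (the ground-state energy of `(2K+1)³` particles is at most the
energy of that window, `LayeredHull.wb_lower`). [folklore] -/
theorem shp_lower_window {a' c : ℝ} (ha' : 0 < a') (hc : 0 < c) (s : ℤ → ℤ)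
    (A : EuclideanSpace ℝ (Fin 3) →ₗᵢ[ℝ] EuclideanSpace ℝ (Fin 3)) :
    ∃ C : ℝ, ∀ K : ℕ,
      2 * groundStateEnergy lennardJones 3 ((2 * K + 1) ^ 3) ≤
      ((2 * K + 1 : ℕ) : ℝ) ^ 2 * (2 * ((1 / 12) * ((a' ^ 2)⁻¹ ^ 6 *
          ∑ k ∈ Finset.Icc (-(K : ℤ)) K, barlowSiteEnergy (fun r => (r ^ 2)⁻¹ ^ 6) 1 c s k) -
        (1 / 6) * ((a' ^ 2)⁻¹ ^ 3 * ∑ k ∈ Finset.Icc (-(K : ℤ)) K, barlowSiteEnergy (fun r => (r ^ 2)⁻¹ ^ 3) 1 c s k))) +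
        C * ∑ p ∈ (hcpSumCube K).image (fun t : ℤ × ℤ × ℤ => A (barlowPos a' (a' * c) s t.1 t.2.1 t.2.2)),
          (1 + Metric.infDist p (A '' barlowStacking a' (a' * c) s \
            ↑((hcpSumCube K).image fun t : ℤ × ℤ × ℤ => A (barlowPos a' (a' * c) s t.1 t.2.1 t.2.2))))⁻¹ ^ 3 := by
  have hδ : 0 < min a' (a' * c) := lt_min ha' (mul_pos ha' hc)
  obtain ⟨C, hC⟩ := LayeredHull.wb_lower (min a' (a' * c)) hδ
  refine ⟨C, fun K => ?_⟩
  have h := hC (A '' barlowStacking a' (a' * c) s) (shp_sep_image ha'.le (mul_pos ha' hc).le s A) _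
    (shp_cube_subset a' (a' * c) s A K)
  rw [shp_cube_energy ha' hc s A K, shp_cube_card ha' (mul_pos ha' hc) s A K, shp_sum_layers_linear,
    ← Finset.mul_sum, ← Finset.mul_sum] at h
  linarith

end Summit.AtomisticToContinuum.Crystallization.Theorems.PeriodicWindowsSketch

end
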